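import Literature.MathematicalPhysics.QuantumFieldTheory.Balaban1983to89.HaarDensitySpecialUnitaryExplicit
import Literature.MathematicalPhysics.QuantumFieldTheory.Balaban1983to89.HaarExponentialChartMeasure

/-!
# `Balaban1983to89.HaarDensityUnitaryChart` — [Balaban1985UV3] p. 260, THE HAAR MEASURE OF `U(N)` AND `SU(N)` IN
# EXPONENTIAL COORDINATES WITH THE EXPLICIT DENSITY `Π_{j,k} sinc((θ_j − θ_k)/2)`:
# `∫_{V_s} F dμ = c · ∫_{‖A‖<s} F(e^A) Π_{j,k} sin((θ_j−θ_k)/2)/((θ_j−θ_k)/2) dA`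

statement-level skeleton of published theorems with citation tags; proofs where landed; nothing here is a claim
about the Yang–Mills mass gap

Mega-formalization `lit-balaban` (HOME `run/shared/lean/pub/lit-balaban/`), unit `lit-balaban-p28` gen 11 (Phase-2
proof seat, free-target protocol G.5-34(d); TAKING 2026-08-22T08:47Z).  File F7 of the gen-11 target: the GLUE between
the explicit determinants of F3 (`HaarDensityUnitaryExplicit`, `𝔲(N)`) / F4 (`HaarDensitySpecialUnitaryExplicit`,
`𝔰𝔲(N)`) — stated on `CompactKillingForm.unitaryLie` / `su` with `jac` read in the `L^∞`-operator norm scope — and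
the MEASURE-LEVEL Haar statements of gen 10 (`HaarExponentialChartMeasure.lintegral_haar_unitaryGroup_window_eq`,
`lintegral_haar_specialUnitaryGroup_window_eq`: `∫_{V_s} F dμ = (μ(V_s)/∫ρ) ∫_{‖A‖<s} F(e^A) ρ(A) dA` with the
ABSTRACT density `ρ = jacDensity = |det jac|`, read on the charts `unitaryLogChart` / `specialUnitaryLogChart` in the
`L²`-operator norm scope).  SKELETON rows served (SUPPORT cells only, no head change): B10.Eq21 / display E18
([Balaban1985UV3] (18)/(21) pp. 260–261, owner r07), B13.Eq1.37 / Lem2 (owner r10), B12.Eq2.10–2.12 (r09/r20).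

CITATION HEADER.  [Balaban1985UV3] T. Bałaban, CMP **102** (1985) 255–275, p. 260: *«dU′ = σ(A′)dA′ … σ(A′) is a
density which can be calculated explicitly for all classical groups. For example for SU(2) we have σ(A) = 1/2π²
(sin|A|/|A|)²»*.  [Helgason2000] Ch. I §1 **Thm. 1.14** (12)/(13) p. 96 (`∫ f dg = ∫ f(exp X) det((1 − e^{−adX})/adX) dX`
near `e`) — tree: r10 `B13HaarSigmaJacobian.jac`, `det_jac_real_eq_sigmaRel`, `det_jac_real_nonneg`; gen 10
`HaarExponentialChart.jacDensity`, `lintegral_haar_unitaryGroup_window_eq`.  [Sepanski2007] **Thm. 5.14** (PDF p. 152).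

WHAT IS PROVED (theorems only; 0 definitions, 0 named facts, 0 sorry; axioms standard).
* §1 `unitaryLogChart_lie_eq` / `specialUnitaryLogChart_lie_eq`: the charts' Lie algebras ARE `(unitaryLie n)`,
  `(su n)` as real subspaces of `M_N(ℂ)`.
* §2 NORM-FREE TRANSFER: `sigmaRel_toMatrix_eq_prod_sinc_of_roots(_su)` — for ANY real subspace `𝐠` equal to `𝔲(N)`
  (resp. `𝔰𝔲(N)`), any basis `b` and any linear `T` acting as `ad(−x)`: `σrel([T]_b ⊗ ℂ) = Π_{j,k} sinc((θ_j − θ_k)/2)`,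
  `iθ_j` the characteristic roots of `x` — F3/F4 through r10's `det_jac_real_eq_sigmaRel`, with the norm scope (in
  which `jac` is summed) eliminated from the statement, so that it can be read back in ANY norm scope.
* §3 ON THE CHARTS (`L²`-operator scope of the gen-10 files): **`det_jac_unitaryLogChart_eq_prod_sinc(_of_roots)`,
  `det_jac_specialUnitaryLogChart_eq_prod_sinc(_of_roots)`** and **`jacDensity_unitaryLogChart_eq(_of_roots)`,
  `jacDensity_specialUnitaryLogChart_eq(_of_roots)`: `jacDensity x = ofReal (Π_j Π_k sinc((θ_j − θ_k)/2))`**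
  (`|det jac| = det jac` by r10's `det_jac_real_nonneg`).
* §4 **THE HAAR MEASURE OF `U(N)` / `SU(N)` IN EXPONENTIAL COORDINATES, EXPLICIT DENSITY**:
  `lintegral_haar_unitaryGroup_window_eq_prod_sinc`, `lintegral_haar_specialUnitaryGroup_window_eq_prod_sinc` — for
  every Haar measure `μ`, every Lebesgue measure `η` on the Lie algebra, `0 < s ≤ s_C`, measurable `F ≥ 0`:
  `∫_{V_s} F dμ = (μ(V_s) / ∫_{‖A‖<s} ρ dη) · ∫_{‖A‖<s} F(e^A) ρ(A) dη(A)` with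
  **`ρ(A) = Π_j Π_k sinc((θ_j(A) − θ_k(A))/2)`**, `θ(A)` = the eigenvalues of the Hermitian matrix `−iA` (Mathlib's
  `IsHermitian.eigenvalues`); versions `_of_roots` with any labelling `θ` of the characteristic roots.

HONEST SCOPE.  (i) `U(N)`, `SU(N)` only (types B/C/D: see F5 `HaarDensityCompactExplicit` for the density in terms of
the roots of `ad`, root tables not computed).  (ii) The normalising constant is left as `μ(V_s)/∫ρ` exactly as in the
gen-10 statement (print's `σ₀`; for `SU(2)` and the Haar probability measure it is r07's `1/2π²`,
`B10Eq18SigmaSU2Chart`).  (iii) Nothing of F3/F4, `B13HaarSigmaJacobian`, `HaarExponentialChart*` is re-proved; this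
file only threads them.
-/

noncomputable section

open scoped ENNReal
open Module Polynomial Matrix MeasureTheory
open _root_.Complex (I)

namespace Literature.MathematicalPhysics.QuantumFieldTheory.Balaban1983to89.HaarDensityUnitaryChart

open B13HaarSigma (sigmaRel)
open B13HaarSigmaJacobian (adg jac adg_apply_coe hlie_lieSubalgebra det_jac_real_eq_sigmaRel det_jac_real_nonneg)
open HaarDensityUnitaryExplicit (isHermitian_neg_I_smul roots_charpoly_eq_of_skewHermitian
  det_jac_unitaryLie_eq_prod_sinc_of_roots)
open HaarDensitySpecialUnitaryExplicit (det_jac_su_eq_prod_sinc_of_roots)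
open Literature.Algebra.Lie.CompactKillingForm (unitaryLie su mem_su_iff mem_unitaryLie_iff)
open HaarExponentialChart (jacDensity jacDensity_def isChartRep_unitaryGroup isChartRep_specialUnitaryGroup
  lie_adStable_unitaryGroup lie_adStable_specialUnitaryGroup lintegral_haar_unitaryGroup_window_eq
  lintegral_haar_specialUnitaryGroup_window_eq)

-- Mathlib idiom (as in `B12LieComplexification`, `B13HaarSigmaJacobian` §7, `CompactKillingForm`, F2–F5): the
-- commutator bracket on an associative ring is the NON-instance `LieRing.ofAssociativeRing`, enabled file-locally; it
-- overrides nothing (there is no global `LieRing (Matrix n n ℂ)`), and the tree's `su`, `unitaryLie` are stated with it.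
attribute [local instance 100] LieRing.ofAssociativeRing

variable {n : Type*} [Fintype n] [DecidableEq n]

/-! ## §1  The charts' Lie algebras are `𝔲(N)`, `𝔰𝔲(N)` -/

section Lie

open scoped Matrix.Norms.L2Operator

/-- `(unitaryLogChart N).lie = 𝔲(N)` as real subspaces of `M_N(ℂ)`. [cite: Helgason2000, Ch. I §1 Thm. 1.14 (12) p. 96] -/
theorem unitaryLogChart_lie_eq : (unitaryLogChart n).lie = (unitaryLie n).toSubmodule := by
  ext X
  rw [mem_unitaryLogChart_lie, LieSubalgebra.mem_toSubmodule, mem_unitaryLie_iff, star_eq_conjTranspose]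

/-- `(specialUnitaryLogChart N).lie = 𝔰𝔲(N)` as real subspaces of `M_N(ℂ)`.
[cite: Helgason2000, Ch. I §1 Thm. 1.14 (12) p. 96] -/
theorem specialUnitaryLogChart_lie_eq [Nonempty n] : (specialUnitaryLogChart n).lie = (su n).toSubmodule := by
  ext X
  rw [mem_specialUnitaryLogChart_lie, LieSubalgebra.mem_toSubmodule, mem_su_iff, star_eq_conjTranspose]

end Lie

/-! ## §2  Norm-free transfer of F3/F4: `σrel([ad(−x)]_b ⊗ ℂ) = Π_{j,k} sinc((θ_j − θ_k)/2)` -/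

section Transfer

open scoped Matrix.Norms.Operator

/-- **Norm-free form of F3**: for any real subspace `𝐠 = 𝔲(N)` of `M_N(ℂ)`, any basis `b`, any linear `T` on `𝐠` acting
as `ad(−x) = (y ↦ yx − xy)`, and any labelling `iθ_j` of the characteristic roots of `x`:
`σrel([T]_b ⊗ ℂ) = Π_j Π_k sinc((θ_j − θ_k)/2)` (r10's `det_jac_real_eq_sigmaRel` read backwards through F3's
`det_jac_unitaryLie_eq_prod_sinc_of_roots`). [cite: Balaban1985UV3, p. 260]
[cite: Helgason2000, Ch. I §1 Thm. 1.14 (12) p. 96] [cite: Sepanski2007, Thm. 5.14] -/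
theorem sigmaRel_toMatrix_eq_prod_sinc_of_roots {𝔤 : Submodule ℝ (Matrix n n ℂ)}
    (h𝔤 : 𝔤 = (unitaryLie n).toSubmodule) {ι : Type*} [Fintype ι] [DecidableEq ι] (b : Basis ι ℝ 𝔤) (x : 𝔤)
    (T : 𝔤 →ₗ[ℝ] 𝔤) (hT : ∀ y : 𝔤, ((T y : 𝔤) : Matrix n n ℂ) = (y : Matrix n n ℂ) * x - x * y) (θ : n → ℝ)
    (hθ : (x : Matrix n n ℂ).charpoly.roots = Finset.univ.val.map fun j => I * (θ j : ℂ)) :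
    sigmaRel ((LinearMap.toMatrix b b T).map (algebraMap ℝ ℂ)) =
      algebraMap ℝ ℂ (∏ j, ∏ k, Real.sinc ((θ j - θ k) / 2)) := by
  subst h𝔤
  have hT' : T = ((adg (hlie_lieSubalgebra (unitaryLie n)) (-x) :
      (unitaryLie n).toSubmodule →L[ℝ] (unitaryLie n).toSubmodule) :
        (unitaryLie n).toSubmodule →ₗ[ℝ] (unitaryLie n).toSubmodule) := by
    ext y : 2
    rw [hT, ContinuousLinearMap.coe_coe, adg_apply_coe, Submodule.coe_neg]
    noncomm_ring
  rw [hT', ← det_jac_real_eq_sigmaRel, det_jac_unitaryLie_eq_prod_sinc_of_roots x θ hθ]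

/-- **Norm-free form of F4** (`𝐠 = 𝔰𝔲(N)`, `N ≥ 1`): `σrel([T]_b ⊗ ℂ) = Π_j Π_k sinc((θ_j − θ_k)/2)` for `T` acting as
`ad(−x)`. [cite: Balaban1985UV3, p. 260] [cite: Helgason2000, Ch. I §1 Thm. 1.14 (12) p. 96] [cite: Sepanski2007, Thm. 5.14] -/
theorem sigmaRel_toMatrix_eq_prod_sinc_of_roots_su [Nonempty n] {𝔤 : Submodule ℝ (Matrix n n ℂ)}
    (h𝔤 : 𝔤 = (su n).toSubmodule) {ι : Type*} [Fintype ι] [DecidableEq ι] (b : Basis ι ℝ 𝔤) (x : 𝔤)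
    (T : 𝔤 →ₗ[ℝ] 𝔤) (hT : ∀ y : 𝔤, ((T y : 𝔤) : Matrix n n ℂ) = (y : Matrix n n ℂ) * x - x * y) (θ : n → ℝ)
    (hθ : (x : Matrix n n ℂ).charpoly.roots = Finset.univ.val.map fun j => I * (θ j : ℂ)) :
    sigmaRel ((LinearMap.toMatrix b b T).map (algebraMap ℝ ℂ)) =
      algebraMap ℝ ℂ (∏ j, ∏ k, Real.sinc ((θ j - θ k) / 2)) := by
  subst h𝔤
  have hT' : T = ((adg (hlie_lieSubalgebra (su n)) (-x) : (su n).toSubmodule →L[ℝ] (su n).toSubmodule) :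
        (su n).toSubmodule →ₗ[ℝ] (su n).toSubmodule) := by
    ext y : 2
    rw [hT, ContinuousLinearMap.coe_coe, adg_apply_coe, Submodule.coe_neg]
    noncomm_ring
  rw [hT', ← det_jac_real_eq_sigmaRel, det_jac_su_eq_prod_sinc_of_roots x θ hθ]

end Transfer

/-! ## §3  On the charts: `det jac = Π sinc`, `jacDensity = ofReal (Π sinc)` -/

section Chart

open scoped Matrix.Norms.L2Operator

/-- **`det jac(x) = Π_j Π_k sinc((θ_j − θ_k)/2)` on the `U(N)` chart's Lie algebra**, `iθ_j` the characteristic roots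
of `x` (any labelling). [cite: Balaban1985UV3, p. 260] [cite: Helgason2000, Ch. I §1 Thm. 1.14 (12) p. 96]
[cite: Sepanski2007, Thm. 5.14] -/
theorem det_jac_unitaryLogChart_eq_prod_sinc_of_roots (x : (unitaryLogChart n).lie) (θ : n → ℝ)
    (hθ : (x : Matrix n n ℂ).charpoly.roots = Finset.univ.val.map fun j => I * (θ j : ℂ)) :
    LinearMap.det (jac (lie_adStable_unitaryGroup (n := n)) x : (unitaryLogChart n).lie →ₗ[ℝ] (unitaryLogChart n).lie) =
      ∏ j, ∏ k, Real.sinc ((θ j - θ k) / 2) := by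
  classical
  apply (algebraMap ℝ ℂ).injective
  have hT : ∀ y : (unitaryLogChart n).lie,
      ((((adg (lie_adStable_unitaryGroup (n := n)) (-x) :
        (unitaryLogChart n).lie →L[ℝ] (unitaryLogChart n).lie) :
          (unitaryLogChart n).lie →ₗ[ℝ] (unitaryLogChart n).lie) y : (unitaryLogChart n).lie) : Matrix n n ℂ) =
        (y : Matrix n n ℂ) * x - x * y := fun y => by
    rw [ContinuousLinearMap.coe_coe, adg_apply_coe, Submodule.coe_neg]
    noncomm_ring
  rw [det_jac_real_eq_sigmaRel (lie_adStable_unitaryGroup (n := n)) (Module.finBasis ℝ (unitaryLogChart n).lie) x]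
  exact sigmaRel_toMatrix_eq_prod_sinc_of_roots (𝔤 := (unitaryLogChart n).lie) unitaryLogChart_lie_eq
    (Module.finBasis ℝ (unitaryLogChart n).lie) x _ hT θ hθ

/-- `x ∈ (unitaryLogChart N).lie` is skew-Hermitian. [cite: Helgason2000, Ch. I §1 Thm. 1.14 (12) p. 96] -/
theorem conjTranspose_eq_neg_of_mem_unitaryLogChart (x : (unitaryLogChart n).lie) : (x : Matrix n n ℂ)ᴴ = -x := by
  rw [← star_eq_conjTranspose]
  exact mem_unitaryLogChart_lie.1 x.2

/-- **`det jac(x) = Π_j Π_k sinc((θ_j − θ_k)/2)` on the `U(N)` chart, `θ = (−ix).eigenvalues`** (hypothesis-free).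
[cite: Balaban1985UV3, p. 260] [cite: Helgason2000, Ch. I §1 Thm. 1.14 (12) p. 96] [cite: Sepanski2007, Thm. 5.14] -/
theorem det_jac_unitaryLogChart_eq_prod_sinc (x : (unitaryLogChart n).lie) :
    LinearMap.det (jac (lie_adStable_unitaryGroup (n := n)) x : (unitaryLogChart n).lie →ₗ[ℝ] (unitaryLogChart n).lie) =
      ∏ j, ∏ k, Real.sinc (((isHermitian_neg_I_smul (conjTranspose_eq_neg_of_mem_unitaryLogChart x)).eigenvalues j -
        (isHermitian_neg_I_smul (conjTranspose_eq_neg_of_mem_unitaryLogChart x)).eigenvalues k) / 2) :=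
  det_jac_unitaryLogChart_eq_prod_sinc_of_roots x _
    (roots_charpoly_eq_of_skewHermitian (conjTranspose_eq_neg_of_mem_unitaryLogChart x))

/-- **`jacDensity x = ofReal (Π_j Π_k sinc((θ_j − θ_k)/2))` on the `U(N)` chart** (`|det jac| = det jac ≥ 0`, r10's
`det_jac_real_nonneg`). [cite: Balaban1985UV3, p. 260] [cite: Helgason2000, Ch. I §1 Thm. 1.14 (12) p. 96] -/
theorem jacDensity_unitaryLogChart_eq_of_roots (x : (unitaryLogChart n).lie) (θ : n → ℝ)
    (hθ : (x : Matrix n n ℂ).charpoly.roots = Finset.univ.val.map fun j => I * (θ j : ℂ)) :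
    jacDensity (lie_adStable_unitaryGroup (n := n)) x = ENNReal.ofReal (∏ j, ∏ k, Real.sinc ((θ j - θ k) / 2)) := by
  rw [jacDensity_def, abs_of_nonneg (det_jac_real_nonneg _ x), det_jac_unitaryLogChart_eq_prod_sinc_of_roots x θ hθ]

/-- `jacDensity x = ofReal (Π_j Π_k sinc((θ_j − θ_k)/2))` on the `U(N)` chart, `θ = (−ix).eigenvalues`.
[cite: Balaban1985UV3, p. 260] [cite: Helgason2000, Ch. I §1 Thm. 1.14 (12) p. 96] -/
theorem jacDensity_unitaryLogChart_eq (x : (unitaryLogChart n).lie) :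
    jacDensity (lie_adStable_unitaryGroup (n := n)) x = ENNReal.ofReal (∏ j, ∏ k,
      Real.sinc (((isHermitian_neg_I_smul (conjTranspose_eq_neg_of_mem_unitaryLogChart x)).eigenvalues j -
        (isHermitian_neg_I_smul (conjTranspose_eq_neg_of_mem_unitaryLogChart x)).eigenvalues k) / 2)) := by
  rw [jacDensity_def, abs_of_nonneg (det_jac_real_nonneg _ x), det_jac_unitaryLogChart_eq_prod_sinc x]

variable [Nonempty n]

/-- **`det jac(x) = Π_j Π_k sinc((θ_j − θ_k)/2)` on the `SU(N)` chart's Lie algebra**, `iθ_j` the characteristic roots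
of `x`. [cite: Balaban1985UV3, p. 260] [cite: Helgason2000, Ch. I §1 Thm. 1.14 (12) p. 96] [cite: Sepanski2007, Thm. 5.14] -/
theorem det_jac_specialUnitaryLogChart_eq_prod_sinc_of_roots (x : (specialUnitaryLogChart n).lie) (θ : n → ℝ)
    (hθ : (x : Matrix n n ℂ).charpoly.roots = Finset.univ.val.map fun j => I * (θ j : ℂ)) :
    LinearMap.det (jac (lie_adStable_specialUnitaryGroup (n := n)) x :
        (specialUnitaryLogChart n).lie →ₗ[ℝ] (specialUnitaryLogChart n).lie) =
      ∏ j, ∏ k, Real.sinc ((θ j - θ k) / 2) := by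
  classical
  apply (algebraMap ℝ ℂ).injective
  have hT : ∀ y : (specialUnitaryLogChart n).lie,
      ((((adg (lie_adStable_specialUnitaryGroup (n := n)) (-x) :
        (specialUnitaryLogChart n).lie →L[ℝ] (specialUnitaryLogChart n).lie) :
          (specialUnitaryLogChart n).lie →ₗ[ℝ] (specialUnitaryLogChart n).lie) y :
            (specialUnitaryLogChart n).lie) : Matrix n n ℂ) = (y : Matrix n n ℂ) * x - x * y := fun y => by
    rw [ContinuousLinearMap.coe_coe, adg_apply_coe, Submodule.coe_neg]
    noncomm_ring
  rw [det_jac_real_eq_sigmaRel (lie_adStable_specialUnitaryGroup (n := n))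
    (Module.finBasis ℝ (specialUnitaryLogChart n).lie) x]
  exact sigmaRel_toMatrix_eq_prod_sinc_of_roots_su (𝔤 := (specialUnitaryLogChart n).lie) specialUnitaryLogChart_lie_eq
    (Module.finBasis ℝ (specialUnitaryLogChart n).lie) x _ hT θ hθ

/-- `x ∈ (specialUnitaryLogChart N).lie` is skew-Hermitian. [cite: Helgason2000, Ch. I §1 Thm. 1.14 (12) p. 96] -/
theorem conjTranspose_eq_neg_of_mem_specialUnitaryLogChart (x : (specialUnitaryLogChart n).lie) :
    (x : Matrix n n ℂ)ᴴ = -x := by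
  rw [← star_eq_conjTranspose]
  exact (mem_specialUnitaryLogChart_lie.1 x.2).1

/-- **`det jac(x) = Π_j Π_k sinc((θ_j − θ_k)/2)` on the `SU(N)` chart, `θ = (−ix).eigenvalues`** (hypothesis-free).
[cite: Balaban1985UV3, p. 260] [cite: Helgason2000, Ch. I §1 Thm. 1.14 (12) p. 96] [cite: Sepanski2007, Thm. 5.14] -/
theorem det_jac_specialUnitaryLogChart_eq_prod_sinc (x : (specialUnitaryLogChart n).lie) :
    LinearMap.det (jac (lie_adStable_specialUnitaryGroup (n := n)) x :
        (specialUnitaryLogChart n).lie →ₗ[ℝ] (specialUnitaryLogChart n).lie) =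
      ∏ j, ∏ k, Real.sinc
        (((isHermitian_neg_I_smul (conjTranspose_eq_neg_of_mem_specialUnitaryLogChart x)).eigenvalues j -
          (isHermitian_neg_I_smul (conjTranspose_eq_neg_of_mem_specialUnitaryLogChart x)).eigenvalues k) / 2) :=
  det_jac_specialUnitaryLogChart_eq_prod_sinc_of_roots x _
    (roots_charpoly_eq_of_skewHermitian (conjTranspose_eq_neg_of_mem_specialUnitaryLogChart x))

/-- **`jacDensity x = ofReal (Π_j Π_k sinc((θ_j − θ_k)/2))` on the `SU(N)` chart.** [cite: Balaban1985UV3, p. 260]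
[cite: Helgason2000, Ch. I §1 Thm. 1.14 (12) p. 96] -/
theorem jacDensity_specialUnitaryLogChart_eq_of_roots (x : (specialUnitaryLogChart n).lie) (θ : n → ℝ)
    (hθ : (x : Matrix n n ℂ).charpoly.roots = Finset.univ.val.map fun j => I * (θ j : ℂ)) :
    jacDensity (lie_adStable_specialUnitaryGroup (n := n)) x =
      ENNReal.ofReal (∏ j, ∏ k, Real.sinc ((θ j - θ k) / 2)) := by
  rw [jacDensity_def, abs_of_nonneg (det_jac_real_nonneg _ x),
    det_jac_specialUnitaryLogChart_eq_prod_sinc_of_roots x θ hθ]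

/-- `jacDensity x = ofReal (Π_j Π_k sinc((θ_j − θ_k)/2))` on the `SU(N)` chart, `θ = (−ix).eigenvalues`.
[cite: Balaban1985UV3, p. 260] [cite: Helgason2000, Ch. I §1 Thm. 1.14 (12) p. 96] -/
theorem jacDensity_specialUnitaryLogChart_eq (x : (specialUnitaryLogChart n).lie) :
    jacDensity (lie_adStable_specialUnitaryGroup (n := n)) x = ENNReal.ofReal (∏ j, ∏ k, Real.sinc
      (((isHermitian_neg_I_smul (conjTranspose_eq_neg_of_mem_specialUnitaryLogChart x)).eigenvalues j -
        (isHermitian_neg_I_smul (conjTranspose_eq_neg_of_mem_specialUnitaryLogChart x)).eigenvalues k) / 2)) := by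
  rw [jacDensity_def, abs_of_nonneg (det_jac_real_nonneg _ x), det_jac_specialUnitaryLogChart_eq_prod_sinc x]

end Chart

/-! ## §4  The Haar measure of `U(N)` / `SU(N)` in exponential coordinates with the explicit density -/

section Haar

open scoped Matrix.Norms.L2Operator

/-- **HAAR MEASURE OF `U(N)` IN EXPONENTIAL COORDINATES, EXPLICIT DENSITY** ([Balaban1985UV3] p. 260 «dU′ = σ(A′)dA′ …
calculated explicitly»): for every Haar measure `μ` on `U(N)`, every Lebesgue measure `η` on `𝔲(N)`, `0 < s ≤ s_C`,
measurable `F ≥ 0` and ANY labelling `iθ_j(A)` of the characteristic roots of `A ∈ 𝔲(N)`: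
`∫_{V_s} F dμ = (μ(V_s) / ∫_{‖A‖<s} ρ dη) · ∫_{‖A‖<s} F(e^A) ρ(A) dη(A)`, **`ρ(A) = Π_j Π_k sinc((θ_j(A) − θ_k(A))/2)`**.
[cite: Balaban1985UV3, p. 260] [cite: Helgason2000, Ch. I §1 Thm. 1.14 (13) p. 96] -/
theorem lintegral_haar_unitaryGroup_window_eq_prod_sinc_of_roots
    [MeasurableSpace (unitaryLogChart n).lie] [BorelSpace (unitaryLogChart n).lie]
    (η : Measure (unitaryLogChart n).lie) [η.IsAddHaarMeasure]
    (μ : Measure (Matrix.unitaryGroup n ℂ)) [μ.IsHaarMeasure] {s : ℝ} (hs0 : 0 < s)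
    (hs : s ≤ HaarExponentialChart.IsChartRep.chartRadius (unitaryLogChart n)) {F : Matrix.unitaryGroup n ℂ → ℝ≥0∞}
    (hF : Measurable F) (θ : (unitaryLogChart n).lie → n → ℝ)
    (hθ : ∀ A : (unitaryLogChart n).lie,
      (A : Matrix n n ℂ).charpoly.roots = Finset.univ.val.map fun j => I * (θ A j : ℂ)) :
    ∫⁻ g in (isChartRep_unitaryGroup (n := n)).window s, F g ∂μ =
      (μ ((isChartRep_unitaryGroup (n := n)).window s) /
          ∫⁻ A in Metric.ball 0 s, ENNReal.ofReal (∏ j, ∏ k, Real.sinc ((θ A j - θ A k) / 2)) ∂η) *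
        ∫⁻ A in Metric.ball 0 s, F ((isChartRep_unitaryGroup (n := n)).expChart A) *
          ENNReal.ofReal (∏ j, ∏ k, Real.sinc ((θ A j - θ A k) / 2)) ∂η := by
  have hρ : ∀ A : (unitaryLogChart n).lie, jacDensity (lie_adStable_unitaryGroup (n := n)) A =
      ENNReal.ofReal (∏ j, ∏ k, Real.sinc ((θ A j - θ A k) / 2)) :=
    fun A => jacDensity_unitaryLogChart_eq_of_roots A (θ A) (hθ A)
  have h := lintegral_haar_unitaryGroup_window_eq η μ hs0 hs hF
  simp only [hρ] at h
  exact h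

/-- **HAAR MEASURE OF `U(N)` IN EXPONENTIAL COORDINATES, EXPLICIT DENSITY, hypothesis-free**:
`ρ(A) = Π_j Π_k sinc((θ_j(A) − θ_k(A))/2)` with `θ(A)` = the eigenvalues of the Hermitian matrix `−iA`.
[cite: Balaban1985UV3, p. 260] [cite: Helgason2000, Ch. I §1 Thm. 1.14 (13) p. 96] -/
theorem lintegral_haar_unitaryGroup_window_eq_prod_sinc
    [MeasurableSpace (unitaryLogChart n).lie] [BorelSpace (unitaryLogChart n).lie]
    (η : Measure (unitaryLogChart n).lie) [η.IsAddHaarMeasure]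
    (μ : Measure (Matrix.unitaryGroup n ℂ)) [μ.IsHaarMeasure] {s : ℝ} (hs0 : 0 < s)
    (hs : s ≤ HaarExponentialChart.IsChartRep.chartRadius (unitaryLogChart n)) {F : Matrix.unitaryGroup n ℂ → ℝ≥0∞}
    (hF : Measurable F) :
    ∫⁻ g in (isChartRep_unitaryGroup (n := n)).window s, F g ∂μ =
      (μ ((isChartRep_unitaryGroup (n := n)).window s) /
          ∫⁻ A in Metric.ball 0 s, ENNReal.ofReal (∏ j, ∏ k,
            Real.sinc (((isHermitian_neg_I_smul (conjTranspose_eq_neg_of_mem_unitaryLogChart A)).eigenvalues j -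
              (isHermitian_neg_I_smul (conjTranspose_eq_neg_of_mem_unitaryLogChart A)).eigenvalues k) / 2)) ∂η) *
        ∫⁻ A in Metric.ball 0 s, F ((isChartRep_unitaryGroup (n := n)).expChart A) *
          ENNReal.ofReal (∏ j, ∏ k,
            Real.sinc (((isHermitian_neg_I_smul (conjTranspose_eq_neg_of_mem_unitaryLogChart A)).eigenvalues j -
              (isHermitian_neg_I_smul (conjTranspose_eq_neg_of_mem_unitaryLogChart A)).eigenvalues k) / 2)) ∂η :=
  lintegral_haar_unitaryGroup_window_eq_prod_sinc_of_roots η μ hs0 hs hF _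
    fun A => roots_charpoly_eq_of_skewHermitian (conjTranspose_eq_neg_of_mem_unitaryLogChart A)

variable [Nonempty n]

/-- **HAAR MEASURE OF `SU(N)` IN EXPONENTIAL COORDINATES, EXPLICIT DENSITY** (print's example group; for `N = 2` the
density is `sinc(|A|)²` and the constant `1/2π²`, r07's `B10Eq18SigmaSU2Chart`): for every Haar measure `μ` on `SU(N)`,
every Lebesgue measure `η` on `𝔰𝔲(N)`, `0 < s ≤ s_C`, measurable `F ≥ 0`, any labelling `iθ_j(A)` of the characteristic
roots: `∫_{V_s} F dμ = (μ(V_s) / ∫_{‖A‖<s} ρ dη) · ∫_{‖A‖<s} F(e^A) ρ(A) dη(A)`,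
**`ρ(A) = Π_j Π_k sinc((θ_j(A) − θ_k(A))/2)`**. [cite: Balaban1985UV3, p. 260] [cite: Helgason2000, Ch. I §1 Thm. 1.14 (13) p. 96] -/
theorem lintegral_haar_specialUnitaryGroup_window_eq_prod_sinc_of_roots
    [MeasurableSpace (specialUnitaryLogChart n).lie] [BorelSpace (specialUnitaryLogChart n).lie]
    (η : Measure (specialUnitaryLogChart n).lie) [η.IsAddHaarMeasure]
    (μ : Measure (Matrix.specialUnitaryGroup n ℂ)) [μ.IsHaarMeasure] {s : ℝ} (hs0 : 0 < s)
    (hs : s ≤ HaarExponentialChart.IsChartRep.chartRadius (specialUnitaryLogChart n))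
    {F : Matrix.specialUnitaryGroup n ℂ → ℝ≥0∞} (hF : Measurable F) (θ : (specialUnitaryLogChart n).lie → n → ℝ)
    (hθ : ∀ A : (specialUnitaryLogChart n).lie,
      (A : Matrix n n ℂ).charpoly.roots = Finset.univ.val.map fun j => I * (θ A j : ℂ)) :
    ∫⁻ g in (isChartRep_specialUnitaryGroup (n := n)).window s, F g ∂μ =
      (μ ((isChartRep_specialUnitaryGroup (n := n)).window s) /
          ∫⁻ A in Metric.ball 0 s, ENNReal.ofReal (∏ j, ∏ k, Real.sinc ((θ A j - θ A k) / 2)) ∂η) *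
        ∫⁻ A in Metric.ball 0 s, F ((isChartRep_specialUnitaryGroup (n := n)).expChart A) *
          ENNReal.ofReal (∏ j, ∏ k, Real.sinc ((θ A j - θ A k) / 2)) ∂η := by
  have hρ : ∀ A : (specialUnitaryLogChart n).lie, jacDensity (lie_adStable_specialUnitaryGroup (n := n)) A =
      ENNReal.ofReal (∏ j, ∏ k, Real.sinc ((θ A j - θ A k) / 2)) :=
    fun A => jacDensity_specialUnitaryLogChart_eq_of_roots A (θ A) (hθ A)
  have h := lintegral_haar_specialUnitaryGroup_window_eq η μ hs0 hs hF
  simp only [hρ] at h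
  exact h

/-- **HAAR MEASURE OF `SU(N)` IN EXPONENTIAL COORDINATES, EXPLICIT DENSITY, hypothesis-free**:
`ρ(A) = Π_j Π_k sinc((θ_j(A) − θ_k(A))/2)`, `θ(A)` = the eigenvalues of `−iA`.
[cite: Balaban1985UV3, p. 260] [cite: Helgason2000, Ch. I §1 Thm. 1.14 (13) p. 96] -/
theorem lintegral_haar_specialUnitaryGroup_window_eq_prod_sinc
    [MeasurableSpace (specialUnitaryLogChart n).lie] [BorelSpace (specialUnitaryLogChart n).lie]
    (η : Measure (specialUnitaryLogChart n).lie) [η.IsAddHaarMeasure]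
    (μ : Measure (Matrix.specialUnitaryGroup n ℂ)) [μ.IsHaarMeasure] {s : ℝ} (hs0 : 0 < s)
    (hs : s ≤ HaarExponentialChart.IsChartRep.chartRadius (specialUnitaryLogChart n))
    {F : Matrix.specialUnitaryGroup n ℂ → ℝ≥0∞} (hF : Measurable F) :
    ∫⁻ g in (isChartRep_specialUnitaryGroup (n := n)).window s, F g ∂μ =
      (μ ((isChartRep_specialUnitaryGroup (n := n)).window s) /
          ∫⁻ A in Metric.ball 0 s, ENNReal.ofReal (∏ j, ∏ k, Real.sinc
            (((isHermitian_neg_I_smul (conjTranspose_eq_neg_of_mem_specialUnitaryLogChart A)).eigenvalues j -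
              (isHermitian_neg_I_smul (conjTranspose_eq_neg_of_mem_specialUnitaryLogChart A)).eigenvalues k) / 2)) ∂η) *
        ∫⁻ A in Metric.ball 0 s, F ((isChartRep_specialUnitaryGroup (n := n)).expChart A) *
          ENNReal.ofReal (∏ j, ∏ k, Real.sinc
            (((isHermitian_neg_I_smul (conjTranspose_eq_neg_of_mem_specialUnitaryLogChart A)).eigenvalues j -
              (isHermitian_neg_I_smul (conjTranspose_eq_neg_of_mem_specialUnitaryLogChart A)).eigenvalues k) / 2)) ∂η :=
  lintegral_haar_specialUnitaryGroup_window_eq_prod_sinc_of_roots η μ hs0 hs hF _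
    fun A => roots_charpoly_eq_of_skewHermitian (conjTranspose_eq_neg_of_mem_specialUnitaryLogChart A)

end Haar

end Literature.MathematicalPhysics.QuantumFieldTheory.Balaban1983to89.HaarDensityUnitaryChart
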